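import Summits.HodgeConjecture.HodgeConjecture.Cruxes.BlochSeedDiscOne.KunnethNoInterference
import Summits.HodgeConjecture.HodgeConjecture.Cruxes.BlochSeedDiscOne.RowAlpha1RuleDSharp

/-!
line stmt-HodgeConjecture-18881 Cruxes/BlochSeedDiscOne/Lines/birth.lean 814a6a70c14e831a stub_rung_pad4_seedAt

# DoorSPhiShellTwo — why the σ-currency closure of shell 2 does NOT extend to the (8♮) `Φ⁺_all` currency (hsemireg-sheaf8-1 g10, 2026-08-31;
# director-hodge R19.883 ∕ R19.885 second item «door S shell 2 in the (8♮) `phiAllPlus` room»; companion of the memo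
# `Cruxes/BlochSeedDiscOne/DOORS-PHI-SHELL2-INHABITED-sheaf8-1-g10.md`)

KERNEL PART (this file).  hsem-2's probe C (memo-180) closes shell 2 of every v42 room `(RD, PP; σ, 0)` with `RD ⟹ RuleD` through
`ring2_not_sieveRows₀`, whose budget hypothesis is `hσ : ∀ D, 28·copies(D) ≤ σ D` (true for `σ = sigmaH`: `SigmaH.diag_le_sigmaH`).  For the decoration-free
floor `σ = KunnethNoInterference.phiAllPlus` that hypothesis is FALSE: the one-arrow legged design `RowAlpha1.DLeg` of the tree (`RowAlpha1RuleDSharp` §3) has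
`copies = 2` and `Φ⁺_all = 0` (its single block is degenerate: a null leg of multiple `4`; the degenerate pools `degPN₂ = 84`, `degNP₂ = 28` swallow the
diagonal `56`) — `phiAllPlus_DLeg`, `not_diag_le_phiAllPlus`.  So the inequality chain of the σ-rooms has no (8♮) analogue, and in the (8♮) currency the budget row
of a `Φ⁺_all = 0` design is the bare rank cap (`budgetClause_phiAllPlus_iff_of_eq_zero`, cf. `RowAlpha3.rank_le_116_of_honest`).

NUMERICS PART (the memo, evidence on 18881; NOT kernel).  Shell 2 of door S's (8♮) room is in fact INHABITED: the explicit symmetric ring-2 letter design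
`DOORS-PHI-SHELL2-WITNESS-A2-4-5.json` 705e47be06997404 (1 664 cells, copies 10 944, rank 64, μ = 384) satisfies
`SieveRows₀ RowAlpha1.RuleDSharp lawPP 14 phiAllPlus 0` conjunct by conjunct (RuleDSharp 9 984 blocks; weak max-flow `5 440 = Σ_P`, `HallPlusUp 8`; `Φ⁺_all = 0`,
budget `1 680 ≤ 3 136`) — numerics ×1 (evaluator calibrated on this tree's B136 digits), (A1) ∕ μ ∕ rank ∕ Disj ∕ RuleD ×2 by an independent engine; so
`SPlus₀ RuleDSharp lawPP 14 phiAllPlus 0` (the hypothesis `hS` of `SheafDoor.not_stub_rung2aSheaf_of_sPlus₀_phi`) is expected FALSE, pending ×2 ∕ kernel.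

LETTER-MODEL bookkeeping only; letters ≠ sheaves ≠ SEED; nothing here is proved toward 18881 ∕ 30548 ∕ H2 ∕ № 4 ∕ HC_AV ∕ HC_CM ∕ HC.  No `sorry`, no `axiom`,
no `instance`, no notation; digits by `decide +kernel` on a two-entry design, as in `KunnethNoInterference` §5.
-/

set_option linter.dupNamespace false
set_option autoImplicit false

namespace Summit.HodgeConjecture.HodgeConjecture.Cruxes.BlochSeedDiscOne.DoorSPhiShellTwo

open Summit.HodgeConjecture.HodgeConjecture.Cruxes.BlochSeedDiscOne.DepthBoundA4
open Summit.HodgeConjecture.HodgeConjecture.Cruxes.BlochSeedDiscOne.RuleDPlate (BudgetClause)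
open Summit.HodgeConjecture.HodgeConjecture.Cruxes.BlochSeedDiscOne.SigmaH (extPN extNP)
open Summit.HodgeConjecture.HodgeConjecture.Cruxes.BlochSeedDiscOne.RowAlpha3 (extPNcap extNPcap pos)
open Summit.HodgeConjecture.HodgeConjecture.Cruxes.BlochSeedDiscOne.KunnethNoInterference
  (phiAllPlus degPN degNP crossNNcap crossPPcap)
open Summit.HodgeConjecture.HodgeConjecture.Cruxes.BlochSeedDiscOne.RowAlpha1 (DLeg)

/-! ## §1 The digits of the one-arrow legged design `DLeg` (`P = [(xLeg, 1)]`, `N = [(yLeg, 1)]`, one null leg of multiple `4`) -/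

/-- `copies DLeg = 2`. -/
theorem copies_DLeg : DLeg.copies = 2 := by decide +kernel

/-- the capped `h²(Hom(𝓟,𝓝))` pool: `[4,4,0]·(1+t)⁶` at `t²` = `4·15 + 4·6 = 84`. -/
theorem extPNcap_DLeg_two : extPNcap DLeg 2 = 84 := by decide +kernel

/-- the separated value is `0` (the block is degenerate). -/
theorem extPN_DLeg_two : extPN DLeg 2 = 0 := by decide +kernel

/-- the capped `h²(Hom(𝓝,𝓟))` pool: `[0,4,4]·(1+t)⁶` at `t²` = `4·6 + 4 = 28`. -/
theorem extNPcap_DLeg_two : extNPcap DLeg 2 = 28 := by decide +kernel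

theorem extNP_DLeg_two : extNP DLeg 2 = 0 := by decide +kernel

theorem extPN_DLeg_one : extPN DLeg 1 = 0 := by decide +kernel

theorem extNP_DLeg_three : extNP DLeg 3 = 0 := by decide +kernel

/-- single-entry sides: no cross-type same-side blocks. -/
theorem crossNNcap_DLeg_one : crossNNcap DLeg 1 = 0 := by decide +kernel

theorem crossPPcap_DLeg_one : crossPPcap DLeg 1 = 0 := by decide +kernel

theorem crossNNcap_DLeg_three : crossNNcap DLeg 3 = 0 := by decide +kernel

theorem crossPPcap_DLeg_three : crossPPcap DLeg 3 = 0 := by decide +kernel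

/-- the degenerate pools: `degPN₂(DLeg) = 84`, `degNP₂(DLeg) = 28`. -/
theorem degPN_DLeg_two : degPN DLeg 2 = 84 := by
  unfold degPN
  rw [extPNcap_DLeg_two, extPN_DLeg_two]
  norm_num

theorem degNP_DLeg_two : degNP DLeg 2 = 28 := by
  unfold degNP
  rw [extNPcap_DLeg_two, extNP_DLeg_two]
  norm_num

/-- **`Φ⁺_all(DLeg) = (56 − 84 − 28)⁺ + (0 − 0 − 28)⁺ + (0 − 0 − 84)⁺ = 0`**: on a legged block the degenerate pools swallow the diagonal. -/
theorem phiAllPlus_DLeg : phiAllPlus DLeg = 0 := by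
  unfold phiAllPlus pos
  rw [degPN_DLeg_two, degNP_DLeg_two, copies_DLeg, extPN_DLeg_one, extNP_DLeg_three, crossNNcap_DLeg_one, crossPPcap_DLeg_one,
    crossNNcap_DLeg_three, crossPPcap_DLeg_three, extNPcap_DLeg_two, extPNcap_DLeg_two]
  norm_num

/-! ## §2 The σ-room hypothesis fails for `Φ⁺_all`; the (8♮) budget of a `Φ⁺_all = 0` design is the bare rank cap -/

/-- **the budget hypothesis of the shell-2 σ-closure (`∀ D, 28·copies ≤ σ D`, hsem-2 probe C `ring2_not_sieveRows₀`; `ShellLedger.ringRoom_two_closed_sigma`)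
is FALSE for `σ = Φ⁺_all`** — witnessed by `DLeg` (`56 ≰ 0`). -/
theorem not_diag_le_phiAllPlus : ¬ ∀ D : Design, 28 * (D.copies : ℤ) ≤ phiAllPlus D := by
  intro h
  have h1 := h DLeg
  rw [phiAllPlus_DLeg, copies_DLeg] at h1
  norm_num at h1

/-- for a design with `Φ⁺_all = 0` the (8♮) budget row with rider `π` reads `28·(rank − 4) + π ≤ 3136` — at `π = 0`: `rank ≤ 116`, nothing else. -/
theorem budgetClause_phiAllPlus_iff_of_eq_zero (D : Design) (h0 : phiAllPlus D = 0) (π : ℤ) :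
    BudgetClause phiAllPlus π D ↔ 28 * (D.rank - 4) + π ≤ 3136 := by
  unfold BudgetClause
  rw [h0, zero_add]

/-- … in particular at the rider of record `π = 0`: `BudgetClause Φ⁺_all 0 D ↔ rank ≤ 116`. -/
theorem budgetClause_phiAllPlus_zero_iff_rank_le (D : Design) (h0 : phiAllPlus D = 0) : BudgetClause phiAllPlus 0 D ↔ D.rank ≤ 116 := by
  rw [budgetClause_phiAllPlus_iff_of_eq_zero D h0 0]
  omega

/-! ## Audit -/

/-- AUDIT: letter arithmetic on a two-entry design and one unfolding; decides nothing about 18881 ∕ 30548 ∕ H2 ∕ HC.  The inhabitant of shell 2 of door S's (8♮)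
room is NUMERICS in the companion memo, not a theorem of this file. -/
theorem audit_nothing_decided : True := trivial

end Summit.HodgeConjecture.HodgeConjecture.Cruxes.BlochSeedDiscOne.DoorSPhiShellTwo
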